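/-
COR-CM (cell pub-hodgecm2, stage 2 of the Hodge ladder) — Δ2 BRIDGE, the ι₁ ∕ ῑ₁ seam of the (c)+(d) residual, sub-socket S-c
«at ῑ₁ under the re-keyed `adm′`» (COORDINATOR 21:29Z).  Seat prover-pub-hodgecm2-d2bridge-wb-1-g0-0 (WALL-BREAKER 1).
The LINE-TYPE half of the conjugation dictionary: how the dictionary's two line-keyed predicates — `PhiMu i := ι₁ ∈ Φ^δ(a_i)` and
`adm i d := d.IsReflexOfTypeG ι₁ Φ^δ(a_i)` (`Φ^δ(a) = HodgeCM.SignRecipe.lineType a`, the δ-positive type of the Gram scalar) —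
transform under `ι₁ ↦ ῑ₁ := conj ∘ ι₁`, and what they read in EITHER outcome of the T-SIGN test (`Φ_μ = Φ^δ(a)` «MIRROR» vs
`Φ_μ = Φ̄^δ(a)` «CONJ»).  Theorems only: no definition, no named fact, no `sorry`; nothing landed is edited or restated.
FRAMING: HC_CM is NOT proved; «Δ2 BRIDGE CLOSED» is NOT claimed; no pointer moves.
-/
import Summits.HodgeConjecture.CorCM.D2Bridge.ReflexOfTypeConj
import Summits.HodgeConjecture.CorCM.D2Bridge.HcmS1PinAdmLine
import HarnessLib

set_option autoImplicit false

/-!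
# Δ2 bridge, S-c at ῑ₁: the δ-positive line type under complex conjugation

`Φ^δ(a) = lineType a = {τ | 0 < Im τ(δ_L a)}` (`HodgeCM/Model/Binders/JLiuLineType`).  With `ῑ := (starRingEnd ℂ).comp ι`
and `Φ̄ = HodgeCM.CMTypeOps.bar Φ` (the conjugate = complementary CM type):

* §1 `conjugate_mem_lineType_iff` ∕ `starRingEnd_comp_mem_lineType_iff` — `τ̄ ∈ Φ^δ(a) ↔ τ ∈ Φ^δ(−a)`;
  `bar_lineType` — **`Φ̄^δ(a) = Φ^δ(−a)`**: conjugating the type is negating the Gram scalar.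
* §2 `isReflexOfTypeG_conj_lineType_iff` — **`d.IsReflexOfTypeG ῑ₁ Φ^δ(a) ↔ d.IsReflexOfTypeG ι₁ Φ^δ(−a)`** (the landed seam lemma
  `isReflexOfTypeG_conj_iff` + §1): the dictionary's admissibility RE-KEYED AT `ῑ₁` (branch (c-S), realisation (c-S.1)) is the
  LITERAL admissibility at the sign-flipped line — the two candidate edits of `liuDictionaryPin`'s `adm` coincide.
* §3 the two outcomes of the T-SIGN test at a line with Gram scalar `a` and character `μ`:
  `cmType_eq_lineType_neg_of_deltaNeg` — if `Im τ(δ_L a) < 0` on `Φ_μ` then `Φ_μ = Φ^δ(−a) = Φ̄^δ(a)` («CONJ»; the «MIRROR» case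
  `Φ_μ = Φ^δ(a)` is prove-1's ✔ `cmType_eq_lineType_of_deltaPos`); and the admissibility junctions
  `isReflexOfTypeG_conj_cmType_iff_lineType_of_deltaNeg` — CONJ: **`d.IsReflexOfTypeG ῑ₁ Φ_μ ↔ d.IsReflexOfTypeG ι₁ Φ^δ(a)`**
  (S1 run at the geometric instance `ῑ₁` feeds the dictionary's `adm` AS KEYED — the (c)+(d) socket closes at `ῑ₁`),
  `isReflexOfTypeG_conj_cmType_iff_lineType_neg_of_deltaPos` — MIRROR: `d.IsReflexOfTypeG ῑ₁ Φ_μ ↔ d.IsReflexOfTypeG ι₁ Φ^δ(−a)`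
  (S1 at `ῑ₁` feeds only the RE-KEYED `adm′`), and the `PhiMu` readings `starRingEnd_comp_mem_cmType_iff_of_deltaNeg ∕ _of_deltaPos`
  (CONJ: Liu's «`τ′ ∈ Φ_μ`» at `τ′ = ῑ₁` IS the dictionary's `PhiMu i`; MIRROR: it is its negation at the flipped line).

References: Y. Liu, arXiv:2102.11518 = Camb. J. Math. 9 (2021), Def. 4.3 (2), Rem. 4.4, Def. 4.12 (FJcycle.tex l. 2102–2108),
proof of Thm. 4.18 l. 2250; G. Shimura, *Abelian Varieties with CM* (1998) §8.3 Prop. 28.  HC_CM is NOT proved.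
-/

noncomputable section

namespace Summit.HodgeConjecture.CorCM.D2Bridge

open NumberField NumberField.ComplexEmbedding
open Literature.AlgebraicGeometry.Motives (CMType)
open Literature.AlgebraicGeometry.ShimuraVarieties (conjRingHomK)
open Literature.NumberTheory.Automorphic Literature.NumberTheory.Automorphic.IdeleClassGroup
open Literature.NumberTheory.GelbartRogawski1991.UnitaryDualPair (imagUnit)
open HodgeCM.Model (LiuCMSide)
open HodgeCM.SignRecipe (lineType)

variable {L : HodgeCM.CMField}

/-! ## §1 `Φ̄^δ(a) = Φ^δ(−a)` -/

/-- A totally real scalar stays totally real under negation. [folklore] -/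
theorem conjRingHomK_neg_of_eq {a : L} (ha : conjRingHomK L a = a) : conjRingHomK L (-a) = -a := by
  rw [map_neg, ha]

/-- **`τ̄ ∈ Φ^δ(a) ↔ τ ∈ Φ^δ(−a)`**: `Im τ̄(δ a) = − Im τ(δ a) = Im τ(δ·(−a))`. [cite: Liu2021, Definition 4.12] -/
theorem conjugate_mem_lineType_iff {a : L} (ha : conjRingHomK L a = a) (ha0 : a ≠ 0) (τ : (L : Type) →+* ℂ) :
    conjugate τ ∈ (lineType a ha ha0).1 ↔ τ ∈ (lineType (-a) (conjRingHomK_neg_of_eq ha) (neg_ne_zero.mpr ha0)).1 := by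
  rw [HodgeCM.SignRecipe.mem_lineType_iff, HodgeCM.SignRecipe.mem_lineType_iff, conjugate_coe_eq, Complex.conj_im,
    mul_neg, map_neg, Complex.neg_im]

/-- The same with the conjugate embedding written `(starRingEnd ℂ).comp τ` (the Δ2 files' `ῑ`). [cite: Liu2021, Definition 4.12] -/
theorem starRingEnd_comp_mem_lineType_iff {a : L} (ha : conjRingHomK L a = a) (ha0 : a ≠ 0) (τ : (L : Type) →+* ℂ) :
    (starRingEnd ℂ).comp τ ∈ (lineType a ha ha0).1 ↔
      τ ∈ (lineType (-a) (conjRingHomK_neg_of_eq ha) (neg_ne_zero.mpr ha0)).1 := by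
  have hc : (starRingEnd ℂ).comp τ = conjugate τ := RingHom.ext fun _ => rfl
  rw [hc, conjugate_mem_lineType_iff]

/-- **`Φ̄^δ(a) = Φ^δ(−a)`**: the conjugate (complementary) type of the δ-positive type of `a` is the δ-positive type of `−a`.
[cite: Liu2021, Definition 4.12 and Remark 4.4] -/
theorem bar_lineType (a : L) (ha : conjRingHomK L a = a) (ha0 : a ≠ 0) :
    HodgeCM.CMTypeOps.bar (lineType a ha ha0) = lineType (-a) (conjRingHomK_neg_of_eq ha) (neg_ne_zero.mpr ha0) := by
  apply Subtype.ext
  ext τ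
  rw [HodgeCM.CMTypeOps.mem_bar_iff, ← HodgeCM.CMTypeOps.conjugate_mem_iff_notMem, conjugate_mem_lineType_iff]

/-- `Φ^δ(−(−a)) = Φ^δ(a)` (bookkeeping). [folklore] -/
theorem lineType_neg_neg (a : L) (ha : conjRingHomK L a = a) (ha0 : a ≠ 0) :
    lineType (-(-a)) (conjRingHomK_neg_of_eq (conjRingHomK_neg_of_eq ha)) (neg_ne_zero.mpr (neg_ne_zero.mpr ha0)) =
      lineType a ha ha0 :=
  HodgeCM.SignRecipe.lineType_congr (neg_neg a) _ _ ha ha0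

/-- `Φ̄^δ(−a) = Φ^δ(a)`. [cite: Liu2021, Definition 4.12 and Remark 4.4] -/
theorem bar_lineType_neg (a : L) (ha : conjRingHomK L a = a) (ha0 : a ≠ 0) :
    HodgeCM.CMTypeOps.bar (lineType (-a) (conjRingHomK_neg_of_eq ha) (neg_ne_zero.mpr ha0)) = lineType a ha ha0 := by
  rw [bar_lineType, lineType_neg_neg]

/-! ## §2 The dictionary's `adm` under `ι₁ ↦ ῑ₁`: re-keying at `ῑ₁` = flipping the sign of the Gram scalar -/

/-- **`d.IsReflexOfTypeG ῑ₁ Φ^δ(a) ↔ d.IsReflexOfTypeG ι₁ Φ^δ(−a)`** — the admissibility predicate of `liuDictionaryPin` re-keyed at the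
conjugate presentation embedding is the literal predicate at the sign-flipped line (✔ `isReflexOfTypeG_conj_iff` + `bar_lineType`).
[cite: Liu2021, Definition 4.3, Remark 4.4, Definition 4.12] [cite: Shimura1998, §8.3 Prop. 28] -/
theorem isReflexOfTypeG_conj_lineType_iff (ι₁ : (L : Type) →+* ℂ) (d : LiuCMSide) (a : L) (ha : conjRingHomK L a = a)
    (ha0 : a ≠ 0) :
    d.IsReflexOfTypeG ((starRingEnd ℂ).comp ι₁) (lineType a ha ha0) ↔
      d.IsReflexOfTypeG ι₁ (lineType (-a) (conjRingHomK_neg_of_eq ha) (neg_ne_zero.mpr ha0)) := by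
  rw [isReflexOfTypeG_conj_iff, bar_lineType]

/-- The same read from the other side: `d.IsReflexOfTypeG ι₁ Φ^δ(a) ↔ d.IsReflexOfTypeG ῑ₁ Φ^δ(−a)`.
[cite: Liu2021, Definition 4.3, Remark 4.4, Definition 4.12] -/
theorem isReflexOfTypeG_lineType_iff_conj_neg (ι₁ : (L : Type) →+* ℂ) (d : LiuCMSide) (a : L) (ha : conjRingHomK L a = a)
    (ha0 : a ≠ 0) :
    d.IsReflexOfTypeG ι₁ (lineType a ha ha0) ↔
      d.IsReflexOfTypeG ((starRingEnd ℂ).comp ι₁) (lineType (-a) (conjRingHomK_neg_of_eq ha) (neg_ne_zero.mpr ha0)) := by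
  rw [isReflexOfTypeG_conj_lineType_iff, lineType_neg_neg]

/-! ## §3 The two outcomes of the T-SIGN test at a line `(μ, a)` -/

section TSign

variable (ι₁ : (L : Type) →+* ℂ)
  {μ : Literature.NumberTheory.Automorphic.IdeleClassGroup L →ₜ* Circle} (hμ : IsConjugateSymplectic L μ)

/-- **CONJ outcome**: if `Im τ(δ_L·a) < 0` for every `τ ∈ Φ_μ`, then `Φ_μ = Φ^δ(−a)` (`= Φ̄^δ(a)`, `bar_lineType`) — the mirror image
of ✔ `cmType_eq_lineType_of_deltaPos`. [cite: Liu2021, Definition 4.12 (FJcycle.tex l. 2102–2108)] -/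
theorem cmType_eq_lineType_neg_of_deltaNeg (a : L) (ha : IsCMField.complexConj (L : Type) a = a) (ha0 : a ≠ 0)
    (hΦ : ∀ τ : (L : Type) →+* ℂ, τ ∈ hμ.cmType.1 → (τ (imagUnit (L : Type) * a)).im < 0) :
    hμ.cmType = lineType (-a) (conjRingHomK_neg_of_eq ha) (neg_ne_zero.mpr ha0) :=
  cmType_eq_of_subset _ _ fun τ hτ => by
    rw [HodgeCM.SignRecipe.mem_lineType_iff, HodgeCM.SignRecipe.eta_eq_imagUnit, mul_neg, map_neg, Complex.neg_im, neg_pos]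
    exact hΦ τ hτ

/-- CONJ outcome, conjugate form: `Φ_μ = Φ̄^δ(a)`. [cite: Liu2021, Definition 4.12, Remark 4.4] -/
theorem cmType_eq_bar_lineType_of_deltaNeg (a : L) (ha : IsCMField.complexConj (L : Type) a = a) (ha0 : a ≠ 0)
    (hΦ : ∀ τ : (L : Type) →+* ℂ, τ ∈ hμ.cmType.1 → (τ (imagUnit (L : Type) * a)).im < 0) :
    hμ.cmType = HodgeCM.CMTypeOps.bar (lineType a ha ha0) := by
  rw [bar_lineType]; exact cmType_eq_lineType_neg_of_deltaNeg hμ a ha ha0 hΦ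

/-- **CONJ outcome, the admissibility junction**: S1 run at the geometric instance `ῑ₁` certifies `d.IsReflexOfTypeG ῑ₁ Φ_μ`
(wb-2's `exists_dLiu_of_objOne_conj` ∕ ✔ `exists_dLiu_of_objOne` at `ῑ₁`), and under CONJ this IS the dictionary's
`adm i d = d.IsReflexOfTypeG ι₁ Φ^δ(a_i)` AS KEYED — so in this outcome the (c)+(d) socket is fed at `ῑ₁` with no re-key.
[cite: Liu2021, Definition 4.3, Remark 4.4, Definition 4.12] -/
theorem isReflexOfTypeG_conj_cmType_iff_lineType_of_deltaNeg (a : L) (ha : IsCMField.complexConj (L : Type) a = a) (ha0 : a ≠ 0)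
    (hΦ : ∀ τ : (L : Type) →+* ℂ, τ ∈ hμ.cmType.1 → (τ (imagUnit (L : Type) * a)).im < 0) (d : LiuCMSide) :
    d.IsReflexOfTypeG ((starRingEnd ℂ).comp ι₁) hμ.cmType ↔ d.IsReflexOfTypeG ι₁ (lineType a ha ha0) := by
  rw [isReflexOfTypeG_conj_iff, cmType_eq_bar_lineType_of_deltaNeg hμ a ha ha0 hΦ, HodgeCM.CMTypeOps.bar_bar]

/-- **MIRROR outcome, the admissibility junction**: under `0 < Im τ(δ_L·a)` on `Φ_μ` (the Ω-pin's orientation hypothesis as landed),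
`d.IsReflexOfTypeG ῑ₁ Φ_μ ↔ d.IsReflexOfTypeG ι₁ Φ^δ(−a)` — S1 at `ῑ₁` feeds only the RE-KEYED predicate (the sign-flipped line), not
`adm i` as keyed; this is the one-conjugation residual of branch (c-S). [cite: Liu2021, Definition 4.3, Remark 4.4, Definition 4.12] -/
theorem isReflexOfTypeG_conj_cmType_iff_lineType_neg_of_deltaPos [IsGalois ℚ L] (a : L)
    (ha : IsCMField.complexConj (L : Type) a = a)
    (ha0 : a ≠ 0) (hΦ : ∀ τ : (L : Type) →+* ℂ, τ ∈ hμ.cmType.1 → 0 < (τ (imagUnit (L : Type) * a)).im) (d : LiuCMSide) :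
    d.IsReflexOfTypeG ((starRingEnd ℂ).comp ι₁) hμ.cmType ↔
      d.IsReflexOfTypeG ι₁ (lineType (-a) (conjRingHomK_neg_of_eq ha) (neg_ne_zero.mpr ha0)) := by
  rw [cmType_eq_lineType_of_deltaPos hμ a ha ha0 hΦ, isReflexOfTypeG_conj_lineType_iff]

/-- **CONJ outcome, the `PhiMu` reading**: Liu's side condition «`τ′ ∈ Φ_μ`» at the geometric pin `τ′ = ῑ₁` IS the dictionary's
`PhiMu i = (ι₁ ∈ Φ^δ(a_i))`. [cite: Liu2021, proof of Theorem 4.18 (FJcycle.tex l. 2250), Definition 4.12] -/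
theorem starRingEnd_comp_mem_cmType_iff_of_deltaNeg (a : L) (ha : IsCMField.complexConj (L : Type) a = a) (ha0 : a ≠ 0)
    (hΦ : ∀ τ : (L : Type) →+* ℂ, τ ∈ hμ.cmType.1 → (τ (imagUnit (L : Type) * a)).im < 0) :
    (starRingEnd ℂ).comp ι₁ ∈ hμ.cmType.1 ↔ ι₁ ∈ (lineType a ha ha0).1 := by
  rw [cmType_eq_lineType_neg_of_deltaNeg hμ a ha ha0 hΦ, starRingEnd_comp_mem_lineType_iff, lineType_neg_neg]

/-- **MIRROR outcome, the `PhiMu` reading**: `ῑ₁ ∈ Φ_μ ↔ ι₁ ∈ Φ^δ(−a)` (equivalently `ι₁ ∉ Φ^δ(a)`): at a `PhiMu` line Liu's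
«`τ′ ∈ Φ_μ`» FAILS at the geometric pin `τ′ = ῑ₁`. [cite: Liu2021, proof of Theorem 4.18 (FJcycle.tex l. 2250), Definition 4.12] -/
theorem starRingEnd_comp_mem_cmType_iff_of_deltaPos [IsGalois ℚ L] (a : L) (ha : IsCMField.complexConj (L : Type) a = a)
    (ha0 : a ≠ 0)
    (hΦ : ∀ τ : (L : Type) →+* ℂ, τ ∈ hμ.cmType.1 → 0 < (τ (imagUnit (L : Type) * a)).im) :
    (starRingEnd ℂ).comp ι₁ ∈ hμ.cmType.1 ↔ ι₁ ∈ (lineType (-a) (conjRingHomK_neg_of_eq ha) (neg_ne_zero.mpr ha0)).1 := by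
  rw [cmType_eq_lineType_of_deltaPos hμ a ha ha0 hΦ, starRingEnd_comp_mem_lineType_iff]

/-- MIRROR outcome, negative form: at a `PhiMu` line (`ι₁ ∈ Φ^δ(a)`), `ῑ₁ ∉ Φ_μ`. [cite: Liu2021, Definition 4.12] -/
theorem starRingEnd_comp_notMem_cmType_of_deltaPos [IsGalois ℚ L] (a : L) (ha : IsCMField.complexConj (L : Type) a = a)
    (ha0 : a ≠ 0)
    (hΦ : ∀ τ : (L : Type) →+* ℂ, τ ∈ hμ.cmType.1 → 0 < (τ (imagUnit (L : Type) * a)).im)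
    (hι : ι₁ ∈ (lineType a ha ha0).1) : (starRingEnd ℂ).comp ι₁ ∉ hμ.cmType.1 := by
  rw [cmType_eq_lineType_of_deltaPos hμ a ha ha0 hΦ]
  have hc : (starRingEnd ℂ).comp ι₁ = conjugate ι₁ := RingHom.ext fun _ => rfl
  rw [hc, HodgeCM.CMTypeOps.conjugate_mem_iff_notMem, not_not]
  exact hι

end TSign

end Summit.HodgeConjecture.CorCM.D2Bridge

end
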